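import Summits.BirchSwinnertonDyer.BirchSwinnertonDyer.Theorems.ResidualThetaTransportAtTwoResidualSignedLambdaLowerCMAtTwoAwayExhaustion
import Summits.BirchSwinnertonDyer.BirchSwinnertonDyer.Theorems.ResidualThetaTransportAtTwoResidualSignedLambdaLowerCMAtTwoCofreeSelmerTransfer
import Literature.NumberTheory.GaloisRepresentations.ContinuousH1OpenKernelProofs
import Literature.NumberTheory.GaloisRepresentations.NumberFieldCdTwoProofs
import HarnessLib

/-!
# Colimit-injectivity along a tower of open subgroups, and the GLOBAL exhaustion of `H¹(Γ_∞, A_ρ)` by level classes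
# `H¹(Γ_n, A_ρ[2^k])` — inputs of the reciprocity stub (EH) of line `onepair`

Route `ResidualThetaTransportAtTwo` (RTT), crux RSL_g `ResidualSignedLambdaLowerCMAtTwo` (stmt-BirchSwinnertonDyer-22608), line «onepair»
(skeleton v3b), split stub EH `stub_reciprocity`; seat `prover-bsd-wall-tp2-p2x-w3` g17 (`--supports`, closes nothing). THEOREMS ONLY (no
definition, no named fact, no instance, no `sorry`). BSD is not proved by any of this; RSL_g (22608) and K3 (20308) stay OPEN.

WHY. The EH text pairs `x ∈ 𝐇¹_Γ(T_ρ)` with an ARBITRARY relaxed Selmer class `s ∈ H¹(Γ_∞, A_ρ)` through the pins; the levelwise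
reciprocity core (`…ReciprocityLevelwise`, p688154) speaks about classes of `H¹(Γ_n, A_ρ[2^k])`. This file supplies the two generic
bridges:
* §1 **colimit-injectivity** (`exists_forall_apply_eq_of_iInf`, `exists_resLe_eq_zero_of_resLe_eq_zero`): for a compact `G`, a
  decreasing family of OPEN subgroups `Sₖ` and a discrete `X` with continuous orbit maps, a continuous cocycle of `S k` that is principal
  on `⨅ⱼ Sⱼ` (resp. a class dying there) is principal with the SAME vector on (resp. dies on) some `S m`, `m ≥ k` — the injectivity half of
  `H¹(⋂ Sₖ, X) = lim→ H¹(Sₖ, X)`, companion of the surjectivity half `ProfiniteExhaustion.exists_resLe_eq_of_iInf` (p698914).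
* §2 **global exhaustion with cocycle control** (`exists_level_cocycle`): every `s ∈ H¹(Γ_∞, A_ρ)` is, for some `k₀`, and for EVERY
  `K ≥ k₀`, the transfer `τ_{n,K} b = res_{Γ_∞ ≤ Γ_n}((A_ρ[2^K] ↪ A_ρ)_* b)` of a level class `b ∈ H¹(Γ_n, A_ρ[2^K])` for all `n ≥ n₀(K)`,
  with a representing cocycle `φ` of `s` whose values lie in `A_ρ[2^K]` and whose class in `H¹(Γ_∞, A_ρ[2^K])` is `res b` (so that a Θ-Kummer
  datum read on `φ` — `CofreeSelmerTransfer.exists_towerKummer_of_cocycle` — is a datum for every such `b`).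

References: [SerreGaloisCohomology1997] I §2.2 Prop. 8; [Shatz1972] Ch. II §2; [Washington1997] §13.1; [GreenbergVatsal2000] §2.
-/

set_option autoImplicit false
-- the Theorems namespace of this sub repeats the summit name by design (D-0017 nested layout)
set_option linter.dupNamespace false

noncomputable section

open scoped Classical

namespace Summit.BirchSwinnertonDyer.BirchSwinnertonDyer.Theorems.ThetaTransport.Reciprocity

open CategoryTheory Field NumberField IsDedekindDomain
  Literature.NumberTheory.EllipticCurves Literature.NumberTheory.GaloisRepresentations
  Literature.NumberTheory.EllipticCurves.GreenbergSelmer Literature.NumberTheory.EllipticCurves.GreenbergVatsal2000 ZpExtension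
  Summit.BirchSwinnertonDyer.BirchSwinnertonDyer.Theorems

universe u v

/-! ## §1 Colimit-injectivity along a tower of open subgroups -/

section ColimitInjective

variable {R : Type u} [Ring R] [TopologicalSpace R]
  {G : Type v} [Group G] [TopologicalSpace G] [IsTopologicalGroup G] [CompactSpace G]
  (X : TopRep.{v} R G) [DiscreteTopology X]

/-- **A cocycle of `S k` that is principal (vector `t`) on `⨅ⱼ Sⱼ` is principal with the same vector on some `S m`, `m ≥ k`**
(`G` compact, `Sₖ` decreasing OPEN subgroups, `X` discrete with continuous orbit maps): the agreement subgroup of the cocycle with `∂t`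
is open and contains `⨅ⱼ Sⱼ`, hence contains some `S m` (`Subgroup.exists_le_of_iInf_le_of_isOpen`).
[cite: SerreGaloisCohomology1997, I §2.2 Prop. 8] [cite: Shatz1972, Ch. II §2] -/
theorem exists_forall_apply_eq_of_iInf (hX : ∀ a : X, Continuous fun g : G ↦ X.ρ g a)
    (S : ℕ → Subgroup G) (hS : Antitone S) (hop : ∀ k, IsOpen ((S k : Subgroup G) : Set G))
    (k : ℕ) (φ : contOneCocycles (subgroupRep X (S k))) (t : X)
    (h0 : ∀ g : S k, (g : G) ∈ ⨅ j, S j → φ.1 g = X.ρ g t - t) :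
    ∃ (m : ℕ) (hkm : k ≤ m), ∀ g : S m, φ.1 ⟨g, hS hkm g.2⟩ = X.ρ g t - t := by
  -- the agreement subgroup, inside `S k`, then inside `G`
  have hXk : Continuous fun g : S k ↦ (subgroupRep X (S k)).ρ g t := (hX t).comp continuous_subtype_val
  have hZo : IsOpen (((principalAgreement (subgroupRep X (S k)) φ t).map (S k).subtype : Subgroup G) : Set G) := by
    rw [Subgroup.coe_map]
    exact (hop k).isOpenMap_subtype_val _ (isOpen_principalAgreement (subgroupRep X (S k)) φ t hXk)
  have hle : (⨅ j, S j) ≤ (principalAgreement (subgroupRep X (S k)) φ t).map (S k).subtype := by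
    intro g hg
    refine ⟨⟨g, (iInf_le S k) hg⟩, ?_, rfl⟩
    rw [SetLike.mem_coe, mem_principalAgreement_iff]
    exact h0 ⟨g, (iInf_le S k) hg⟩ hg
  obtain ⟨m, hm⟩ := Subgroup.exists_le_of_iInf_le_of_isOpen S hS (fun j ↦ (S j).isClosed_of_isOpen (hop j)) _ hZo hle
  refine ⟨max k m, le_max_left k m, fun g ↦ ?_⟩
  obtain ⟨g', hg', hgg'⟩ := hm (hS (le_max_right k m) g.2)
  rw [SetLike.mem_coe, mem_principalAgreement_iff] at hg'
  have hgg : ((g' : S k) : G) = (g : G) := hgg'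
  have e : (⟨(g : G), hS (le_max_left k m) g.2⟩ : S k) = g' := Subtype.ext hgg.symm
  rw [e, hg', subgroupRep_ρ_apply, hgg]

/-- **Colimit-injectivity on classes**: a class of `H¹(S k, X)` that dies on a subgroup `T ⊇ ⨅ⱼ Sⱼ` (e.g. `T = ⨅ⱼ Sⱼ` under its own name)
dies on some `S m`, `m ≥ k`. [cite: SerreGaloisCohomology1997, I §2.2 Prop. 8] [cite: Shatz1972, Ch. II §2] -/
theorem exists_resLe_eq_zero_of_resLe_eq_zero (hX : ∀ a : X, Continuous fun g : G ↦ X.ρ g a)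
    (S : ℕ → Subgroup G) (hS : Antitone S) (hop : ∀ k, IsOpen ((S k : Subgroup G) : Set G))
    {T : Subgroup G} (hT : (⨅ j, S j) ≤ T) (k : ℕ) (hTk : T ≤ S k)
    (y : continuousCohomology 1 (subgroupRep X (S k))) (hy : resLe X hTk 1 y = 0) :
    ∃ (m : ℕ) (hkm : k ≤ m), resLe X (hS hkm) 1 y = 0 := by
  obtain ⟨φ, rfl⟩ := oneCocycleClass_surjective _ y
  rw [resLe_oneCocycleClass, oneCocycleClass_eq_zero_iff] at hy
  obtain ⟨t, ht⟩ := hy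
  obtain ⟨m, hkm, hm⟩ := exists_forall_apply_eq_of_iInf X hX S hS hop k φ t fun g hg ↦ by
    have h := ht ⟨g, hT hg⟩
    rw [contOneCocycles.pullback_apply] at h
    exact h
  refine ⟨m, hkm, ?_⟩
  rw [resLe_oneCocycleClass, oneCocycleClass_eq_zero_iff]
  exact ⟨t, fun g ↦ by rw [contOneCocycles.pullback_apply]; exact hm g⟩

end ColimitInjective

/-! ## §2 Global exhaustion: every class of `H¹(Γ_∞, A_ρ)` is a transfer `τ_{n,K} b`, `K ≥ k₁`, `n ≥ n₁` at will -/

section Global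

variable {p : ℕ} [Fact p.Prime] (S : Set (PadicAlgCl p)) {d : ℕ} (ρ : FramedGaloisRep ℚ ↥(padicCoeffIntegers S) d)
  (κ : ZpExtension ℚ p)

/-- `Γ_∞ = ⋂ₙ Γₙ` under its own name (`ZpExtension.kerSubgroup` is the kernel of `κ`; the tree's `iInf_layerSubgroup_eq_ker`).
[cite: Washington1997, §13.1] -/
theorem kerSubgroup_eq_iInf_layerSubgroup : κ.kerSubgroup = ⨅ n, κ.layerSubgroup n :=
  (iInf_layerSubgroup_eq_ker κ).symm

/-- **GLOBAL EXHAUSTION with a free level.** Every `s ∈ H¹(Γ_∞, A_ρ)` has an exponent `k₁` such that for EVERY `K ≥ k₁` and every floor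
`n₁` there are `n ≥ n₁` and a level class `b ∈ H¹(Γ_n, A_ρ[p^K])` whose transfer `τ_{n,K} b = res_{Γ_∞ ≤ Γ_n}((A_ρ[p^K] ↪ A_ρ)_* b)`
(spelled VERBATIM as in `CofreeSelmerTransfer`) is `s`: a representing cocycle has finitely many values (`Γ_∞` compact, `A_ρ` discrete and
`p`-primary), so it is `A_ρ[p^K]`-valued for every large `K`, and its class in `H¹(Γ_∞, A_ρ[p^K]) = H¹(⋂ₙ Γₙ, ·)` is restricted from a
layer beyond any floor (`ProfiniteExhaustion.exists_resLe_eq_of_eq_iInf_from`, p698914).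
[cite: SerreGaloisCohomology1997, I §2.2 Prop. 8] [cite: GreenbergVatsal2000, §2 Prop. 2.4] -/
theorem exists_transfer_eq (s : subgroupH1 κ.kerSubgroup (Cofree ρ ↥(padicCoeffField S))) :
    ∃ k₁ : ℕ, ∀ K : ℕ, k₁ ≤ K → ∀ n₁ : ℕ, ∃ n : ℕ, n₁ ≤ n ∧
      ∃ b : H1 (cofreeTorsionGaloisModule S ρ ((p ^ K : ℕ) : ℤ)) (κ.layerSubgroup n),
        resOfLe (Cofree ρ ↥(padicCoeffField S)) (κ.kerSubgroup_le_layerSubgroup n)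
          (pushH1 (κ.layerSubgroup n) (AddSubgroup.torsionBy (Cofree ρ ↥(padicCoeffField S)) ((p ^ K : ℕ) : ℤ)).subtype
            (CofreeSelmerTransfer.torsionBy_subtype_smul S ρ ((p ^ K : ℕ) : ℤ)) b) = s := by
  haveI : CompactSpace (absoluteGaloisGroup ℚ) := absoluteGaloisGroup_compactSpace ℚ
  haveI : CompactSpace ↥κ.kerSubgroup := isCompact_iff_compactSpace.mp κ.isClosed_kerSubgroup.isCompact
  obtain ⟨φ, rfl⟩ := oneCocycleClass_surjective (discreteTopRep κ.kerSubgroup (Cofree ρ ↥(padicCoeffField S))) s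
  -- finitely many values, a uniform exponent `k₁`
  have hfin : (Set.range φ.1).Finite := (isCompact_range φ.1.continuous).finite_of_discrete
  choose j hj using ProfiniteExhaustion.exists_pow_smul_cofree_eq_zero S ρ
  obtain ⟨k₁, hk₁⟩ : ∃ k₁ : ℕ, ∀ a ∈ hfin.toFinset, j a ≤ k₁ := ⟨hfin.toFinset.sup j, fun a ha ↦ Finset.le_sup ha⟩
  refine ⟨k₁, fun K hK n₁ ↦ ?_⟩
  have hmem : ∀ g : κ.kerSubgroup, φ.1 g ∈ AddSubgroup.torsionBy (Cofree ρ ↥(padicCoeffField S)) ((p ^ K : ℕ) : ℤ) := fun g ↦ by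
    have hle : j (φ.1 g) ≤ K := (hk₁ _ (hfin.mem_toFinset.2 ⟨g, rfl⟩)).trans hK
    obtain ⟨e, he⟩ := Nat.exists_eq_add_of_le hle
    have h0 : ((p ^ K : ℕ) : ℤ) • φ.1 g = 0 := by
      rw [natCast_zsmul, he, pow_add, mul_comm, mul_smul, hj, smul_zero]
    exact (Submodule.mem_torsionBy_iff (R := ℤ) _ _).2 h0
  -- the `A_ρ[p^K]`-valued cocycle with the same values
  let ψ : contOneCocycles (subgroupRep (cofreeTorsionGaloisModule S ρ ((p ^ K : ℕ) : ℤ)).toTopRep κ.kerSubgroup) :=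
    ⟨⟨fun g ↦ ⟨φ.1 g, hmem g⟩, φ.1.continuous.subtype_mk _⟩, fun g h ↦ Subtype.ext (by
      change φ.1 (g * h) = φ.1 g + (cofreeTorsionInclusion S ρ ((p ^ K : ℕ) : ℤ)).hom
        ((cofreeTorsionGaloisModule S ρ ((p ^ K : ℕ) : ℤ)).toTopRep.ρ (g : absoluteGaloisGroup ℚ) ⟨φ.1 h, hmem h⟩)
      rw [TopRep.hom_comm_apply, cofreeTorsionInclusion_apply, φ.2]
      rfl)⟩
  have hψ : pushH1 κ.kerSubgroup (AddSubgroup.torsionBy (Cofree ρ ↥(padicCoeffField S)) ((p ^ K : ℕ) : ℤ)).subtype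
      (CofreeSelmerTransfer.torsionBy_subtype_smul S ρ ((p ^ K : ℕ) : ℤ)) (oneCocycleClass _ ψ) = oneCocycleClass _ φ := by
    erw [map_oneCocycleClass]
    exact congrArg _ (Subtype.ext (ContinuousMap.ext fun _ ↦ rfl))
  -- the subgroup half, from the floor `n₁`
  obtain ⟨n, hn, b, hb⟩ := ProfiniteExhaustion.exists_resLe_eq_of_eq_iInf_from (cofreeTorsionGaloisModule S ρ ((p ^ K : ℕ) : ℤ)).toTopRep
    (fun a ↦ (cofreeTorsionGaloisModule S ρ ((p ^ K : ℕ) : ℤ)).continuous_apply_left a)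
    κ.layerSubgroup κ.layerSubgroup_antitone (fun k ↦ (κ.layerSubgroup k).isClosed_of_isOpen (κ.isOpen_layerSubgroup k))
    (kerSubgroup_eq_iInf_layerSubgroup κ) κ.kerSubgroup_le_layerSubgroup n₁ (oneCocycleClass _ ψ)
  refine ⟨n, hn, b, ?_⟩
  rw [ThetaTransport.resOfLe_pushH1]
  -- `resOfLe = resLe` (the two dialects), then `hb`, then `hψ`
  have hb' : resOfLe ↥(AddSubgroup.torsionBy (Cofree ρ ↥(padicCoeffField S)) ((p ^ K : ℕ) : ℤ)) (κ.kerSubgroup_le_layerSubgroup n) b =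
      oneCocycleClass _ ψ := hb
  rw [hb']
  exact hψ

end Global

end Summit.BirchSwinnertonDyer.BirchSwinnertonDyer.Theorems.ThetaTransport.Reciprocity

end
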